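import Summits.MatrixMultiplication.MatrixMultiplication.Theses.TetrahedronCarving
import Summits.MatrixMultiplication.MatrixMultiplication.Theorems.EdgePencilSixthConvexity
import HarnessLib

/-!
# Birth skeleton (BC3) for the crux `TetraExcessZero` (item `stmt-MatrixMultiplication-26697`) of
# route `TetrahedronCarving` — line «rung-and-chord» (replaces «half-edge», generation 23)

`TetraExcessZero : ω(K₄) ≤ ω(2,1,2)` («re-inserting the sixth edge into the diamond costs nothing»).
Along the sixth-edge family `W_n^{(⌈n^δ⌉)}` (edge `01` of bond `n^δ`, the other five of bond `n`;
exponent `χ(δ) = EdgePencil.omegaSix ℂ δ`; `χ(0) = ω(2,1,2) =: ψ`, `χ(1) = ω(K₄) =: T`) the crux is the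
flatness of `χ` on `[0,1]`. Generation 24 proved that `χ` is CONVEX (`EdgePencilSixthConvexity.
omegaSix_convexOn`, from the Kronecker law in the bond `EdgePencilSixthKronecker.tensorRankD_sixTetra_kron_le`).
Consequences for the skeleton:

* the «half-edge» stub `stub_growHalf : T ≤ χ(1/2)` is EQUIVALENT to the crux
  (`growHalf_iff_tetraExcessZero`: a convex non-decreasing `χ` that has reached `χ(1)` at `1/2` is
  constant) — that line was the crux plus a decoration and is withdrawn;
* the crux is EXACTLY (`tetraExcessZero_iff_sixRungPos_and_midTight`) the conjunction of
  `stub_sixRungPos : ∃ δ > 0, χ(δ) ≤ ψ` — ONE rung strictly above the bottom (the bottom rung `δ = 0` is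
  the theorem `sixRung_zero`; a rung makes `χ` vanish to first order at `0`), and
  `stub_midTight : ψ + T ≤ 2·χ(1/2)` — the ladder touches its CHORD at the midpoint (equivalently, by
  convexity, `χ` IS the chord `(1−δ)ψ + δT`: `midTight_iff_noKink`);
  the seam: a convex function vanishing to first order at `0` and equal to its chord has chord slope
  `T − ψ ≤ 0` (`excessZero_of_sixRungPos_of_midTight`).

Both stubs are NECESSARY (`ω = 2 ⟹` each, `sixRungPos_and_midTight_of_matrixMultiplication`), neither
implies the crux or `ω = 2` on its own, and — unlike generation 23's pair — each is satisfied in a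
χ-profile obeying EVERY recorded law (`χ(0)=ψ`, `χ(1)=T`, monotone, CONVEX, `χ(δ) ≤ ψ + δ`,
`T ≤ χ(δ) + 1 − δ`, `(5+δ)T ≤ 6χ(δ)`, `4 ≤ ψ ≤ T ≤ 2ω`) in which the other stub and the crux fail:
the affine profile `χ(δ) = ψ + δ(T−ψ)` at `(ω, ψ, T) = (2.37, 4.08, 4.4)` ⊨ midTight ∧ ¬sixRungPos;
the hinge profile `χ(δ) = max(ψ, ψ + (2δ−1)(T−ψ))` at `(2.37, 4.08, 4.3)` ⊨ sixRungPos(½) ∧ ¬midTight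
(memo NODE-g24 §4, `SixthConvexityWeb`).
-/

set_option linter.dupNamespace false

namespace Summit.MatrixMultiplication.MatrixMultiplication.Cruxes.TetraExcessZero.RungAndChord

open Literature.Computability.AlgebraicComplexity
open Summit.MatrixMultiplication.MatrixMultiplication.Theorems.TetrahedronTensor
open Summit.MatrixMultiplication.MatrixMultiplication.Theorems.EdgePencil
open Summit.MatrixMultiplication.MatrixMultiplication.Theses.TetrahedronCarving

/-- **Stub 1 (one rung above the bottom)**: `∃ δ > 0, χ(δ) ≤ ω(2,1,2)` — a pendant pair of bond `n^δ`
laid across the diamond is free for SOME `δ > 0`. NEC (`sixRung_of_excessZero`); the bottom rung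
`δ = 0` is a theorem (`sixRung_zero`); the MM-cover class cannot certify any `δ > 0` unless `ω = 2`
(`EdgePencilCoverCeiling.weightedCover_ceiling`); open. -/
theorem stub_sixRungPos : ∃ δ : ℝ, 0 < δ ∧ omegaSix ℂ δ ≤ omegaRect ℂ 2 1 2 := by
  sorry

/-- **Stub 2 (midpoint tightness)**: `ω(2,1,2) + ω(K₄) ≤ 2·χ(1/2)` — the half-edge tetrahedron is as
expensive as the average of diamond and tetrahedron; by convexity equivalent to `χ` being its own chord
(`midTight_iff_noKink`). NEC (under the crux `χ ≡ ψ = T`); open. -/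
theorem stub_midTight : omegaRect ℂ 2 1 2 + omegaTetra ℂ ≤ 2 * omegaSix ℂ (1 / 2) := by
  sorry

/-! ## The composition: the crux BY NAME -/

/-- **THE SKELETON THEOREM** (kernel-checked seam, no `sorry` of its own): the crux
`Theses.TetrahedronCarving.TetraExcessZero` (stmt-MatrixMultiplication-26697) concluded BY NAME from the
two registered stubs through the convexity glue `excessZero_of_sixRungPos_of_midTight`.
[cite: LottiRomani1983, §2 (p. 174)] -/
theorem TetraExcessZero_of : TetraExcessZero :=
  tetraExcessZero_of_sixRungPos_of_midTight stub_sixRungPos stub_midTight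

/-- Both stubs are NECESSARY: the crux implies each (neither strengthens the target beyond the crux). -/
theorem stubs_of_TetraExcessZero (h : TetraExcessZero) :
    (∃ δ : ℝ, 0 < δ ∧ omegaSix ℂ δ ≤ omegaRect ℂ 2 1 2) ∧
      omegaRect ℂ 2 1 2 + omegaTetra ℂ ≤ 2 * omegaSix ℂ (1 / 2) :=
  (tetraExcessZero_iff_sixRungPos_and_midTight).1 h

end Summit.MatrixMultiplication.MatrixMultiplication.Cruxes.TetraExcessZero.RungAndChord
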